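import Summits.ResolutionOfSingularities.ResolutionOfSingularities.Theorems.PurelyInseparableDim4ChartChainHistoryEscape
import HarnessLib

/-!
# Purely inseparable four-folds `z^p + F(x₁, …, x₄)`: the DEPTH-THREE HISTORY CRITERION — when the walk's
# third coordinate centre, read on a chart of a chart, is closed in the twice blown-up ambient
# (brick TY-2 g3 (a2), part 2, of cell `res-dim4-pi`)

[OURS · counted 0] (D-0157 DOOR 2; director-resolution DR-157-C; desk WORD #66 (4); frame
`PIDim4.TerminationImpliesOrderReduction`, S3 (c) coordinate regime). Sequel of
`PurelyInseparableDim4ChartChainHistoryEscape.lean` (setting and the escape half there). SETTING: blow up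
`𝔸⁵_K` along `V(z, x_S)` (`π : W → 𝔸⁵`), re-centred `x_j`-chart `φ` at `b` (`j ∈ S`, `b_j = 0`, `Θ`); second
centre `V(z, x_{S'})`, `S.erase j ⊆ S'` (closed in `W`); blow up its global centre (`π₂ : W₂ → W`), re-centred
`x_{j'}`-chart of the chart `φ''` at `b'` (`j' ∈ S'`, `b'_{j'} = 0`, `Θ'`); third centre `V(z, x_{S''})`,
`S'.erase j' ⊆ S'' ∌ j'` (for `S' ⊆ S''` it is closed by typ-2 g2's `isClosed_image_CΛ_chart_of_chart`). PROVED
here (no `sorry`, no new axiom):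

* §4 **`surjective_depth_three`** — CLOSED: if `j' ∉ S.erase j` (the new chart direction is NOT an old fibre
  direction), or `b'_k ≠ 0` for some `k ∈ S' ∖ S` (the point left a base hyperplane the second centre was cut
  by), or `j ∈ S''` and `b'_j ≠ 0` (the third centre lies in the first exceptional divisor and the point left
  its strict transform), then `K[z, x] —Θ'ψ_{j'}Θψ_j→ K[z, x] → K[z, x]/(z, x_{S''})` is ONTO (every free chart
  variable is a polynomial in the original coordinates);
* §5 **`isIntegral_depth_three_iff`** — the composite is integral **iff
  `j' ∉ S.erase j ∨ (∃ k ∈ S' ∖ S, b'_k ≠ 0) ∨ (j ∈ S'' ∧ b'_j ≠ 0)`**; `isIntegral_depth_three_point_iff` — for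
  POINT centres (`S = S' = univ`, third centre the `x_{j'}`-curve) this reads `j' = j ∨ b'_j ≠ 0`, typ-2 g2's
  hand rule «the curve globalises iff ¬(j' ≠ j ∧ b'_j = 0)»;
* §6 **`isClosed_image_CΛ_depth_three_iff`** — THE SCHEME STATEMENT: for ANY blowing up `π` of `𝔸⁵` along
  `V(z, x_S)`, any re-centred chart `φ` (`φ ≫ π = Spec (Θ ∘ ψ_j)`), ANY blowing up `π₂` of the global centre of
  `φ(V(z, x_{S'}))` and the re-centred chart of the chart `φ'' = Spec Θ' ≫ chartImm_{j'} ≫ (π₂⁻¹ φ(𝔸⁵) ↪ W₂)`: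
  `φ''(V(z, x_{S''}))` is CLOSED in `W₂` iff the displayed condition holds. The middle disjunct is escape to
  infinity of the (non-proper) BASE `𝔸⁵` — closed in `W₂` for that reason only; the honest «fibre» content is
  the first and third.

So at depth three the walk's bookkeeping needs exactly two bits of history beyond `(S', j', b')`: whether the
new chart variable was a fibre variable of the PREVIOUS blow-up, and whether the point left the old
exceptional divisor / the old base hyperplanes. Nothing here is a statement about resolution of
singularities in dimension ≥ 4 / characteristic `p` (NOT proved anywhere in this programme). bears_on:
LADDER-RESOLUTION:D157-DOOR2 (res-dim4-pi). Supports stmt-ResolutionOfSingularities-16155 (helper, TY-2 g3 (a2)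
part 2).
-/

-- every declaration of this summit lives under `Summit.ResolutionOfSingularities.ResolutionOfSingularities`
-- (summit = problem), which the duplicate-namespace linter flags; house convention (cf. the Target file).
set_option linter.dupNamespace false

noncomputable section

open MvPolynomial Finset CategoryTheory AlgebraicGeometry Opposite TopologicalSpace
open AlgebraicGeometry.Scheme.IdealSheafData (ofIdealTop vanishingIdeal)

namespace Summit.ResolutionOfSingularities.ResolutionOfSingularities.Theorems.PIDim4

open Literature.AlgebraicGeometry.Resolution
open Literature.AlgebraicGeometry.Resolution.AffinePointBlowup (P A γ coord Wtop)

namespace ChartDictionary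

section DepthThree

variable {K : Type} [Field K] {S S' S'' : Finset (Fin 4)} {j j' : Fin 4} {b b' : Fin 4 → K}
  {Θ Θ' : A 4 K →+* A 4 K}

/-! ## §4 Closedness at depth three -/

/-- **CLOSED AT DEPTH THREE (algebra).** If the new chart direction is NOT an old fibre direction
(`j' ∉ S ∖ {j}`), or the point has left some base hyperplane `x_k = 0`, `k ∈ S' ∖ S` (`b'_k ≠ 0`), or the third
centre lies in the first exceptional divisor and the point has left its strict transform (`j ∈ S''`,
`b'_j ≠ 0`), then `K[z, x] —Θ'ψ_{j'}Θψ_j→ K[z, x] → K[z, x]/(z, x_{S''})` is ONTO (for `S.erase j ⊆ S'`,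
`S'.erase j' ⊆ S''`). -/
theorem surjective_depth_three (hbj : b j = 0) (hC : ∀ c : K, Θ (C c) = C c)
    (hs : ∀ k : Fin 4, Θ (X k.succ) = X k.succ + C (b k)) (hSS' : S.erase j ⊆ S') (hbj' : b' j' = 0)
    (hC' : ∀ c : K, Θ' (C c) = C c) (hs' : ∀ k : Fin 4, Θ' (X k.succ) = X k.succ + C (b' k))
    (hS'S'' : S'.erase j' ⊆ S'')
    (hcl : j' ∉ S.erase j ∨ (∃ k ∈ S' \ S, b' k ≠ 0) ∨ (j ∈ S'' ∧ b' j ≠ 0)) :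
    Function.Surjective ((Ideal.Quotient.mk (AffineCoordBlowup.IΛ 4 K (insert 0 (Fin.succ '' (S'' : Set (Fin 4)))))).comp
        ((Θ'.comp (coordBlowupSubst K (insert 0 (Fin.succ '' (S' : Set (Fin 4)))) j'.succ).toRingHom).comp
          (Θ.comp (coordBlowupSubst K (insert 0 (Fin.succ '' (S : Set (Fin 4)))) j.succ).toRingHom))) := by
  set I := AffineCoordBlowup.IΛ 4 K (insert 0 (Fin.succ '' (S'' : Set (Fin 4)))) with hI
  set Ψ₂ : A 4 K →+* A 4 K :=
    (Θ'.comp (coordBlowupSubst K (insert 0 (Fin.succ '' (S' : Set (Fin 4)))) j'.succ).toRingHom).comp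
      (Θ.comp (coordBlowupSubst K (insert 0 (Fin.succ '' (S : Set (Fin 4)))) j.succ).toRingHom) with hΨ₂
  have hΨX : ∀ a : A 4 K, Ψ₂ a = Θ' (coordBlowupSubst K (insert 0 (Fin.succ '' (S' : Set (Fin 4)))) j'.succ
      (Θ (coordBlowupSubst K (insert 0 (Fin.succ '' (S : Set (Fin 4)))) j.succ a))) := by
    intro a
    simp only [hΨ₂, RingHom.comp_apply, AlgHom.toRingHom_eq_coe, AlgHom.coe_toRingHom]
  have hΨC : ∀ c : K, Ψ₂ (C c) = C c := by
    intro c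
    rw [hΨX, coordBlowupSubst_C, hC, coordBlowupSubst_C, hC']
  have hC'ψ' : ∀ c : K, Θ' (coordBlowupSubst K (insert 0 (Fin.succ '' (S' : Set (Fin 4)))) j'.succ (C c)) = C c := by
    intro c
    rw [coordBlowupSubst_C, hC']
  have hXmem : ∀ k : Fin 4, k ∈ S'' → (X k.succ : A 4 K) ∈ I := fun k hk =>
    Ideal.subset_span ⟨k.succ, Set.mem_insert_of_mem _ ⟨k, hk, rfl⟩, rfl⟩
  -- a residue is in the range as soon as some preimage differs from it by an element of `I`
  have hrange : ∀ (m : Fin (4 + 1)) (a : A 4 K), Ψ₂ a - X m ∈ I →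
      Ideal.Quotient.mk I (X m) ∈ Set.range ((Ideal.Quotient.mk I).comp Ψ₂) := by
    intro m a ha
    refine ⟨a, ?_⟩
    rw [RingHom.comp_apply, Ideal.Quotient.eq]
    exact ha
  refine quotient_comp_surjective_of_X hΨC fun m => ?_
  refine Fin.cases ?_ (fun k => ?_) m
  · -- `z ∈ I`
    refine hrange 0 0 ?_
    rw [map_zero, zero_sub]
    exact I.neg_mem (Ideal.subset_span ⟨0, Set.mem_insert _ _, rfl⟩)
  · by_cases hkS'' : k ∈ S''
    · refine hrange _ 0 ?_
      rw [map_zero, zero_sub]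
      exact I.neg_mem (hXmem k hkS'')
    -- `k ∉ S''`: `k = j'` or `k ∉ S'`
    by_cases hkj' : k = j'
    · subst hkj'
      -- the crux: the residue of the chart variable `x_{j'}`
      rcases hcl with h1 | ⟨k₀, hk₀, hb⟩ | ⟨hjS'', hb⟩
      · -- (i) `j' ∉ S.erase j`: `j' = j` or `j' ∉ S`
        by_cases hjj : k = j
        · subst hjj
          refine hrange _ (X k.succ) ?_
          rw [hΨX, clean_subst_X_chart hbj hs, clean_subst_X_chart hbj' hs', sub_self]
          exact I.zero_mem
        · have hkS : k ∉ S := fun h => h1 (Finset.mem_erase.mpr ⟨hjj, h⟩)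
          refine hrange _ (X k.succ - C (b k)) ?_
          rw [map_sub, hΨC, hΨX, clean_subst_X_base hs hkS, map_add, map_add, hC'ψ', clean_subst_X_chart hbj' hs',
            add_sub_cancel_right, sub_self]
          exact I.zero_mem
      · -- (ii) some `k₀ ∈ S' ∖ S` with `b'_{k₀} ≠ 0`
        obtain ⟨hk₀S', hk₀S⟩ := Finset.mem_sdiff.mp hk₀
        by_cases hk₀j' : k₀ = k
        · subst hk₀j'
          refine hrange _ (X k₀.succ - C (b k₀)) ?_
          rw [map_sub, hΨC, hΨX, clean_subst_X_base hs hk₀S, map_add, map_add, hC'ψ', clean_subst_X_chart hbj' hs',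
            add_sub_cancel_right, sub_self]
          exact I.zero_mem
        · have hk₀S'' : k₀ ∈ S'' := hS'S'' (Finset.mem_erase.mpr ⟨hk₀j', hk₀S'⟩)
          refine hrange _ (C (b' k₀)⁻¹ * (X k₀.succ - C (b k₀))) ?_
          rw [map_mul, map_sub, hΨC, hΨC, hΨX, clean_subst_X_base hs hk₀S, map_add, map_add, hC'ψ',
            clean_subst_X_fibre hbj' hs' hk₀S' hk₀j', add_sub_cancel_right,
            show C (b' k₀)⁻¹ * (X k.succ * (X k₀.succ + C (b' k₀))) - X k.succ =
              C (b' k₀)⁻¹ * X k.succ * X k₀.succ + (C (b' k₀)⁻¹ * C (b' k₀)) * X k.succ - X k.succ by ring,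
            ← map_mul, inv_mul_cancel₀ hb, C_1, one_mul, add_sub_cancel_right]
          exact I.mul_mem_left _ (hXmem k₀ hk₀S'')
      · -- (iii) `j ∈ S''`, `b'_j ≠ 0`
        have hjj : j ≠ k := fun e => hkS'' (e ▸ hjS'')
        by_cases hjS' : j ∈ S'
        · refine hrange _ (C (b' j)⁻¹ * X j.succ) ?_
          rw [map_mul, hΨC, hΨX, clean_subst_X_chart hbj hs, clean_subst_X_fibre hbj' hs' hjS' hjj,
            show C (b' j)⁻¹ * (X k.succ * (X j.succ + C (b' j))) - X k.succ =
              C (b' j)⁻¹ * X k.succ * X j.succ + (C (b' j)⁻¹ * C (b' j)) * X k.succ - X k.succ by ring,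
            ← map_mul, inv_mul_cancel₀ hb, C_1, one_mul, add_sub_cancel_right]
          exact I.mul_mem_left _ (hXmem j hjS'')
        · -- `j ∉ S'`: then `k = j'` is an old fibre direction, or a translated base variable
          by_cases hkS : k ∈ S
          · refine hrange _ (C (b' j)⁻¹ * X k.succ - C (b k)) ?_
            rw [map_sub, map_mul, hΨC, hΨC, hΨX, clean_subst_X_fibre hbj hs hkS hjj.symm, map_mul, map_add,
              map_mul, map_add, hC'ψ', clean_subst_X_base hs' hjS', clean_subst_X_chart hbj' hs',
              show C (b' j)⁻¹ * ((X j.succ + C (b' j)) * (X k.succ + C (b k))) - C (b k) - X k.succ =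
                C (b' j)⁻¹ * (X k.succ + C (b k)) * X j.succ +
                  (C (b' j)⁻¹ * C (b' j) - 1) * (X k.succ + C (b k)) by ring,
              ← map_mul, inv_mul_cancel₀ hb, C_1, sub_self, zero_mul, add_zero]
            exact I.mul_mem_left _ (hXmem j hjS'')
          · refine hrange _ (X k.succ - C (b k)) ?_
            rw [map_sub, hΨC, hΨX, clean_subst_X_base hs hkS, map_add, map_add, hC'ψ', clean_subst_X_chart hbj' hs',
              add_sub_cancel_right, sub_self]
            exact I.zero_mem
    · -- `k ≠ j'`, `k ∉ S''`: then `k ∉ S'`, hence `k = j` or `k ∉ S`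
      have hkS' : k ∉ S' := fun h => hkS'' (hS'S'' (Finset.mem_erase.mpr ⟨hkj', h⟩))
      by_cases hkj : k = j
      · subst hkj
        refine hrange _ (X k.succ - C (b' k)) ?_
        rw [map_sub, hΨC, hΨX, clean_subst_X_chart hbj hs, clean_subst_X_base hs' hkS',
          add_sub_cancel_right, sub_self]
        exact I.zero_mem
      · have hkS : k ∉ S := fun h => hkS' (hSS' (Finset.mem_erase.mpr ⟨hkj, h⟩))
        refine hrange _ (X k.succ - C (b' k + b k)) ?_
        rw [map_sub, hΨC, hΨX, clean_subst_X_base hs hkS, map_add, map_add, hC'ψ',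
          clean_subst_X_base hs' hkS', C_add,
          show X k.succ + C (b' k) + C (b k) - (C (b' k) + C (b k)) - X k.succ = 0 by ring]
        exact I.zero_mem

/-! ## §5 The criterion -/

/-- **THE DEPTH-THREE HISTORY CRITERION (algebra).** With `j ∈ S`, `S.erase j ⊆ S'`, `S'.erase j' ⊆ S''`,
`j' ∉ S''`: `K[z, x] —Θ'ψ_{j'}Θψ_j→ K[z, x] → K[z, x]/(z, x_{S''})` is integral iff
`j' ∉ S.erase j ∨ (∃ k ∈ S' ∖ S, b'_k ≠ 0) ∨ (j ∈ S'' ∧ b'_j ≠ 0)`. -/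
theorem isIntegral_depth_three_iff (hj : j ∈ S) (hbj : b j = 0) (hC : ∀ c : K, Θ (C c) = C c)
    (hs : ∀ k : Fin 4, Θ (X k.succ) = X k.succ + C (b k)) (hSS' : S.erase j ⊆ S') (hbj' : b' j' = 0)
    (hC' : ∀ c : K, Θ' (C c) = C c) (hs' : ∀ k : Fin 4, Θ' (X k.succ) = X k.succ + C (b' k))
    (hS'S'' : S'.erase j' ⊆ S'') (hj'S'' : j' ∉ S'') :
    ((Ideal.Quotient.mk (AffineCoordBlowup.IΛ 4 K (insert 0 (Fin.succ '' (S'' : Set (Fin 4)))))).comp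
        ((Θ'.comp (coordBlowupSubst K (insert 0 (Fin.succ '' (S' : Set (Fin 4)))) j'.succ).toRingHom).comp
          (Θ.comp (coordBlowupSubst K (insert 0 (Fin.succ '' (S : Set (Fin 4)))) j.succ).toRingHom))).IsIntegral ↔
      (j' ∉ S.erase j ∨ (∃ k ∈ S' \ S, b' k ≠ 0) ∨ (j ∈ S'' ∧ b' j ≠ 0)) := by
  constructor
  · intro hint
    by_contra hcl
    simp only [not_or, not_not, not_exists, not_and] at hcl
    obtain ⟨h1, h2, h3⟩ := hcl
    exact not_isIntegral_depth_three hj hbj hC hs hbj' hC' hs' hj'S'' h1 (fun k hk => h2 k hk)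
      (fun hjS'' => h3 hjS'') hint
  · intro hcl
    exact RingHom.isIntegral_of_surjective _
      (surjective_depth_three hbj hC hs hSS' hbj' hC' hs' hS'S'' hcl)

/-- **Point centres** (`S = S' = univ`, third centre the `x_{j'}`-curve `S'' = univ ∖ {j'}`): the composite
is integral — the curve read on the chart of the chart globalises — iff `j' = j ∨ b'_j ≠ 0`, i.e. iff
NOT (`j' ≠ j` and the point lies on the strict transform `x_j = 0` of the first exceptional divisor):
typ-2 g2's hand rule for point → point → curve. -/
theorem isIntegral_depth_three_point_iff (hbj : b j = 0) (hC : ∀ c : K, Θ (C c) = C c)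
    (hs : ∀ k : Fin 4, Θ (X k.succ) = X k.succ + C (b k)) (hbj' : b' j' = 0)
    (hC' : ∀ c : K, Θ' (C c) = C c) (hs' : ∀ k : Fin 4, Θ' (X k.succ) = X k.succ + C (b' k)) :
    ((Ideal.Quotient.mk (AffineCoordBlowup.IΛ 4 K
        (insert 0 (Fin.succ '' ((Finset.univ.erase j' : Finset (Fin 4)) : Set (Fin 4)))))).comp
        ((Θ'.comp (coordBlowupSubst K (insert 0 (Fin.succ '' ((Finset.univ : Finset (Fin 4)) : Set (Fin 4))))
          j'.succ).toRingHom).comp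
          (Θ.comp (coordBlowupSubst K (insert 0 (Fin.succ '' ((Finset.univ : Finset (Fin 4)) : Set (Fin 4))))
            j.succ).toRingHom))).IsIntegral ↔ (j' = j ∨ b' j ≠ 0) := by
  rw [isIntegral_depth_three_iff (Finset.mem_univ j) hbj hC hs (Finset.subset_univ _) hbj' hC' hs'
    (subset_of_eq rfl) (Finset.notMem_erase j' _)]
  simp only [Finset.mem_erase, Finset.mem_univ, and_true, ne_eq, not_not, Finset.sdiff_self,
    Finset.notMem_empty, false_and, exists_false, false_or]
  constructor
  · rintro (h | ⟨-, h⟩)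
    · exact Or.inl h
    · exact Or.inr h
  · rintro (h | h)
    · exact Or.inl h
    · by_cases hjj : j' = j
      · exact Or.inl hjj
      · exact Or.inr ⟨fun e => hjj e.symm, h⟩

end DepthThree

/-! ## §6 The scheme statement -/

section SchemeLevel

variable {K : Type} [Field K] {S S' S'' : Finset (Fin 4)} {j j' : Fin 4} {b b' : Fin 4 → K}
  {Θ Θ' : A 4 K →+* A 4 K} {W W₂ : Scheme.{0}} {π : W ⟶ P 4 K} (φ : P 4 K ⟶ W) [IsOpenImmersion φ]
  {π₂ : W₂ ⟶ W}

/-- **THE DEPTH-THREE HISTORY CRITERION.** Blow up `𝔸⁵_K` along `V(z, x_S)` (`π : W → 𝔸⁵`, any blowing up)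
and let `φ : 𝔸⁵ ⟶ W` be the `x_j`-chart re-centred at `b` (`φ ≫ π = Spec (Θ ∘ ψ_j)`, `j ∈ S`, `b_j = 0`,
`Θ xᵢ = xᵢ + bᵢ`, any cleaning of `z`); let `S.erase j ⊆ S'` (so `φ(V(z, x_{S'}))` is closed in `W`) and blow up
its global centre (`π₂ : W₂ → W`, any blowing up), then pass to the `x_{j'}`-chart of the chart re-centred
at `b'` (`j' ∈ S'`, `b'_{j'} = 0`, `Θ'`) — `φ'' = Spec Θ' ≫ chartImm_{j'} ≫ (π₂⁻¹ φ(𝔸⁵) ↪ W₂)`; let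
`S'.erase j' ⊆ S'' ∌ j'`. Then `φ''(V(z, x_{S''}))` is CLOSED in `W₂` iff
`j' ∉ S.erase j ∨ (∃ k ∈ S' ∖ S, b'_k ≠ 0) ∨ (j ∈ S'' ∧ b'_j ≠ 0)`. -/
theorem isClosed_image_CΛ_depth_three_iff [IsIso (CommRingCat.ofHom Θ')] (hj : j ∈ S) (hbj : b j = 0)
    (hC : ∀ c : K, Θ (C c) = C c) (hs : ∀ k : Fin 4, Θ (X k.succ) = X k.succ + C (b k))
    (hπ : IsBlowup π (AffineCoordBlowup.𝓘Λ 4 K (insert 0 (Fin.succ '' (S : Set (Fin 4))))))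
    (hc : φ ≫ π = Spec.map (CommRingCat.ofHom
      (Θ.comp (coordBlowupSubst K (insert 0 (Fin.succ '' (S : Set (Fin 4)))) j.succ).toRingHom)))
    (hSS' : S.erase j ⊆ S') (hj' : j' ∈ S') (hbj' : b' j' = 0) (hC' : ∀ c : K, Θ' (C c) = C c)
    (hs' : ∀ k : Fin 4, Θ' (X k.succ) = X k.succ + C (b' k))
    (hπ₂ : IsBlowup π₂ (vanishingIdeal (closureImage φ
      ((AffineCoordBlowup.𝓘Λ 4 K (insert 0 (Fin.succ '' (S' : Set (Fin 4))))).support : Set (P 4 K)))))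
    (hS'S'' : S'.erase j' ⊆ S'') (hj'S'' : j' ∉ S'') :
    IsClosed ((Spec.map (CommRingCat.ofHom Θ') ≫
        AffineCoordBlowup.chartImm (isBlowup_restrict_globalCentre φ _ hπ₂) (succ_mem_centreVars hj') ≫
          (π₂ ⁻¹ᵁ φ.opensRange).ι) ''
      (AffineCoordBlowup.CΛ 4 K (insert 0 (Fin.succ '' (S'' : Set (Fin 4)))) : Set (P 4 K))) ↔
      (j' ∉ S.erase j ∨ (∃ k ∈ S' \ S, b' k ≠ 0) ∨ (j ∈ S'' ∧ b' j ≠ 0)) := by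
  haveI : IsProper π := hπ.isProper
  haveI : IsLocallyNoetherian W := LocallyOfFiniteType.isLocallyNoetherian π
  rw [isClosed_image_CΛ_chart_of_chart_iff φ hc hπ₂ (succ_mem_centreVars hj') Θ' _]
  exact isIntegral_depth_three_iff hj hbj hC hs hSS' hbj' hC' hs' hS'S'' hj'S''

end SchemeLevel

end ChartDictionary

end Summit.ResolutionOfSingularities.ResolutionOfSingularities.Theorems.PIDim4

end
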